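import Mathlib

/-!
# Ratio-Cauchy sequences of complex numbers and products close to one

Helper file for item stmt-CriticalPhenomena-8880 (`MarkovBlockPresentation`, route CardyComplexCone of
`CriticalPhenomena/CardyFormulaZ2`), part (ii) "CONTRACTION ⇒ COHERENCE". When Dubois' contraction
principle (support item `ComplexConeContraction`) is iterated over the annulus blocks of a Markov block
presentation, the read-outs `ρ_K` of the reference trajectories of depth `K` form a sequence of NONZERO
complex numbers whose consecutive ratios are geometrically close to one,
`‖ρ_{K+1} / ρ_K − 1‖ ≤ C r^K`. This file proves the two elementary analytic facts used to turn that into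
a universal direction with a rate:

* `ratio_limit` — such a sequence converges to a NONZERO limit `ℓ`, and the limit is reached with the
  uniform relative rate `‖ℓ / ρ_K − 1‖ ≤ C e^{C/(1−r)} / (1−r) · r^K` (the constant depends on `C, r`
  only, not on the sequence);
* `norm_mul_sub_one_le` — `‖ab − 1‖ ≤ α + β + αβ` when `‖a − 1‖ ≤ α`, `‖b − 1‖ ≤ β` (products of
  cross-ratios close to one stay close to one).

Pure analysis over `Mathlib`; no percolation and no cone vocabulary enters here.
-/

namespace Summit.CriticalPhenomena.CardyFormulaZ2.Theorems.MarkovBlockPresentation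

open Filter Topology

/-- Products of two complex numbers close to `1` are close to `1`:
`‖a − 1‖ ≤ α`, `‖b − 1‖ ≤ β` give `‖ab − 1‖ ≤ α + β + αβ`. -/
theorem norm_mul_sub_one_le {a b : ℂ} {α β : ℝ} (ha : ‖a - 1‖ ≤ α) (hb : ‖b - 1‖ ≤ β) :
    ‖a * b - 1‖ ≤ α + β + α * β := by
  have hα : 0 ≤ α := (norm_nonneg _).trans ha
  have h : a * b - 1 = (a - 1) + (b - 1) + (a - 1) * (b - 1) := by ring
  rw [h]
  calc ‖(a - 1) + (b - 1) + (a - 1) * (b - 1)‖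
      ≤ ‖a - 1‖ + ‖b - 1‖ + ‖(a - 1) * (b - 1)‖ := norm_add₃_le
    _ = ‖a - 1‖ + ‖b - 1‖ + ‖a - 1‖ * ‖b - 1‖ := by rw [norm_mul]
    _ ≤ α + β + α * β := by gcongr

/-- If `x ≠ 0` then `‖y − x‖ ≤ ‖x‖ · ‖y / x − 1‖` (indeed with equality). -/
theorem norm_sub_le_norm_mul_norm_div_sub_one {x y : ℂ} (hx : x ≠ 0) :
    ‖y - x‖ ≤ ‖x‖ * ‖y / x - 1‖ := by
  have h : y - x = x * (y / x - 1) := by field_simp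
  rw [h, norm_mul]

/-- **Ratio-Cauchy sequences.** Let `z : ℕ → ℂ` be a sequence of nonzero complex numbers with
`‖z (K+1) / z K − 1‖ ≤ C r^K` for all `K` (`0 ≤ C`, `0 ≤ r < 1`). Then `z` converges to a NONZERO
limit `ℓ`, with the uniform relative rate `‖ℓ / z K − 1‖ ≤ (C e^{C/(1−r)} / (1 − r)) · r^K` for every `K`.
(Proof: `‖z N‖ ≤ ‖z K‖ e^{C/(1−r)}` for `N ≥ K`, so the increments after time `K` are bounded by a
geometric series of ratio `r` and first term `‖z K‖ e^{C/(1−r)} C r^K`; the limit is nonzero because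
`ℓ / z K → 1`.) -/
theorem ratio_limit {z : ℕ → ℂ} {C r : ℝ} (hC : 0 ≤ C) (hr0 : 0 ≤ r) (hr1 : r < 1)
    (hz : ∀ K, z K ≠ 0) (hε : ∀ K, ‖z (K + 1) / z K - 1‖ ≤ C * r ^ K) :
    ∃ ℓ : ℂ, ℓ ≠ 0 ∧ Tendsto z atTop (𝓝 ℓ) ∧
      ∀ K, ‖ℓ / z K - 1‖ ≤ C * Real.exp (C / (1 - r)) / (1 - r) * r ^ K := by
  have h1r : 0 < 1 - r := by linarith
  -- one step: `‖z (K+1)‖ ≤ ‖z K‖ (1 + C r^K)` and `‖z (K+1) - z K‖ ≤ ‖z K‖ C r^K`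
  have hstep : ∀ K, ‖z (K + 1)‖ ≤ ‖z K‖ * (1 + C * r ^ K) := by
    intro K
    have h : z (K + 1) = z K * (1 + (z (K + 1) / z K - 1)) := by field_simp [hz K]; ring
    calc ‖z (K + 1)‖ = ‖z K * ((1 : ℂ) + (z (K + 1) / z K - 1))‖ := congrArg _ h
      _ = ‖z K‖ * ‖(1 : ℂ) + (z (K + 1) / z K - 1)‖ := norm_mul _ _
      _ ≤ ‖z K‖ * (‖(1 : ℂ)‖ + ‖z (K + 1) / z K - 1‖) := by gcongr; exact norm_add_le _ _
      _ ≤ ‖z K‖ * (1 + C * r ^ K) := by rw [norm_one]; gcongr; exact hε K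
  have hdiff : ∀ K, ‖z (K + 1) - z K‖ ≤ ‖z K‖ * (C * r ^ K) := fun K =>
    (norm_sub_le_norm_mul_norm_div_sub_one (hz K)).trans (by gcongr; exact hε K)
  -- growth bound: `‖z N‖ ≤ ‖z K‖ exp (∑_{K ≤ j < N} C r^j) ≤ ‖z K‖ e^{C/(1-r)}`
  have hgrow : ∀ K N, K ≤ N → ‖z N‖ ≤ ‖z K‖ * Real.exp (∑ j ∈ Finset.Ico K N, C * r ^ j) := by
    intro K N hKN
    induction N, hKN using Nat.le_induction with
    | base => simp
    | succ N hKN ih =>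
      calc ‖z (N + 1)‖ ≤ ‖z N‖ * (1 + C * r ^ N) := hstep N
        _ ≤ (‖z K‖ * Real.exp (∑ j ∈ Finset.Ico K N, C * r ^ j)) * Real.exp (C * r ^ N) := by
            gcongr
            linarith [Real.add_one_le_exp (C * r ^ N)]
        _ = ‖z K‖ * Real.exp (∑ j ∈ Finset.Ico K (N + 1), C * r ^ j) := by
            rw [Finset.sum_Ico_succ_top hKN, Real.exp_add, mul_assoc]
  have htail : ∀ K N, ∑ j ∈ Finset.Ico K N, C * r ^ j ≤ C / (1 - r) := by
    intro K N
    rw [← Finset.mul_sum]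
    calc C * ∑ j ∈ Finset.Ico K N, r ^ j ≤ C * (r ^ K / (1 - r)) :=
          mul_le_mul_of_nonneg_left (geom_sum_Ico_le_of_lt_one hr0 hr1) hC
      _ ≤ C * (1 / (1 - r)) := by gcongr; exact pow_le_one₀ hr0 hr1.le
      _ = C / (1 - r) := by ring
  have hgrow' : ∀ K N, K ≤ N → ‖z N‖ ≤ ‖z K‖ * Real.exp (C / (1 - r)) := fun K N h =>
    (hgrow K N h).trans (by gcongr; exact htail K N)
  -- Cauchy, hence convergent
  have hdist : ∀ N, dist (z N) (z (N + 1)) ≤ ‖z 0‖ * Real.exp (C / (1 - r)) * C * r ^ N := by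
    intro N
    rw [dist_comm, dist_eq_norm]
    calc ‖z (N + 1) - z N‖ ≤ ‖z N‖ * (C * r ^ N) := hdiff N
      _ ≤ (‖z 0‖ * Real.exp (C / (1 - r))) * (C * r ^ N) := by
          gcongr; exact hgrow' 0 N (Nat.zero_le N)
      _ = ‖z 0‖ * Real.exp (C / (1 - r)) * C * r ^ N := by ring
  obtain ⟨ℓ, hℓ⟩ := cauchySeq_tendsto_of_complete (cauchySeq_of_le_geometric r _ hr1 hdist)
  -- uniform relative bound at every `K`, via the shifted sequence `N ↦ z (K + N)`
  have hrel : ∀ K, ‖z K - ℓ‖ ≤ ‖z K‖ * (C * Real.exp (C / (1 - r)) / (1 - r) * r ^ K) := by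
    intro K
    have hdistK : ∀ N, dist (z (K + N)) (z (K + (N + 1))) ≤
        (‖z K‖ * Real.exp (C / (1 - r)) * C * r ^ K) * r ^ N := by
      intro N
      rw [dist_comm, dist_eq_norm, ← add_assoc]
      calc ‖z (K + N + 1) - z (K + N)‖ ≤ ‖z (K + N)‖ * (C * r ^ (K + N)) := hdiff (K + N)
        _ ≤ (‖z K‖ * Real.exp (C / (1 - r))) * (C * r ^ (K + N)) := by
            gcongr; exact hgrow' K (K + N) (Nat.le_add_right K N)
        _ = (‖z K‖ * Real.exp (C / (1 - r)) * C * r ^ K) * r ^ N := by rw [pow_add]; ring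
    have hℓK : Tendsto (fun N => z (K + N)) atTop (𝓝 ℓ) := by
      have h := (Filter.tendsto_add_atTop_iff_nat K).2 hℓ
      simpa only [add_comm] using h
    have h := dist_le_of_le_geometric_of_tendsto₀ r _ hr1 hdistK hℓK
    rw [add_zero, dist_eq_norm] at h
    calc ‖z K - ℓ‖ ≤ ‖z K‖ * Real.exp (C / (1 - r)) * C * r ^ K / (1 - r) := h
      _ = ‖z K‖ * (C * Real.exp (C / (1 - r)) / (1 - r) * r ^ K) := by ring
  have hquot : ∀ K, ‖ℓ / z K - 1‖ ≤ C * Real.exp (C / (1 - r)) / (1 - r) * r ^ K := by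
    intro K
    have hzK : 0 < ‖z K‖ := norm_pos_iff.2 (hz K)
    have h : ℓ / z K - 1 = (ℓ - z K) / z K := by field_simp [hz K]
    rw [h, norm_div, div_le_iff₀ hzK, norm_sub_rev]
    calc ‖z K - ℓ‖ ≤ ‖z K‖ * (C * Real.exp (C / (1 - r)) / (1 - r) * r ^ K) := hrel K
      _ = C * Real.exp (C / (1 - r)) / (1 - r) * r ^ K * ‖z K‖ := by ring
  -- the limit is nonzero since `ℓ / z K → 1`
  have hℓ0 : ℓ ≠ 0 := by
    have hsmall : Tendsto (fun K => C * Real.exp (C / (1 - r)) / (1 - r) * r ^ K) atTop (𝓝 0) := by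
      have h := (tendsto_pow_atTop_nhds_zero_of_lt_one hr0 hr1).const_mul
        (C * Real.exp (C / (1 - r)) / (1 - r))
      simpa using h
    obtain ⟨K, hK⟩ := (hsmall.eventually (gt_mem_nhds zero_lt_one)).exists
    intro hℓ0
    have h := (hquot K).trans_lt hK
    rw [hℓ0, zero_div, zero_sub, norm_neg, norm_one] at h
    exact lt_irrefl _ h
  exact ⟨ℓ, hℓ0, hℓ, hquot⟩

/-- `ratio_limit` for sequences controlled from index `1` on (the depth-`K` contraction bounds of the
engine start at `K = 1`): if `z K ≠ 0` and `‖z (K+1) / z K − 1‖ ≤ C r^K` for all `K ≥ 1`, then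
`z → ℓ ≠ 0` and `‖ℓ / z K − 1‖ ≤ (C e^{C/(1−r)} / (1 − r)) · r^K` for all `K ≥ 1` (apply `ratio_limit` to
`K ↦ z (K+1)` with constant `C r`, and use `C r ≤ C` inside the exponential). -/
theorem ratio_limit_from_one {z : ℕ → ℂ} {C r : ℝ} (hC : 0 ≤ C) (hr0 : 0 ≤ r) (hr1 : r < 1)
    (hz : ∀ K, 1 ≤ K → z K ≠ 0) (hε : ∀ K, 1 ≤ K → ‖z (K + 1) / z K - 1‖ ≤ C * r ^ K) :
    ∃ ℓ : ℂ, ℓ ≠ 0 ∧ Tendsto z atTop (𝓝 ℓ) ∧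
      ∀ K, 1 ≤ K → ‖ℓ / z K - 1‖ ≤ C * Real.exp (C / (1 - r)) / (1 - r) * r ^ K := by
  have h1r : 0 < 1 - r := by linarith
  -- shifted sequence `K ↦ z (K + 1)` with constant `C r`
  have hz' : ∀ K, z (K + 1) ≠ 0 := fun K => hz (K + 1) (Nat.le_add_left 1 K)
  have hε' : ∀ K, ‖z (K + 1 + 1) / z (K + 1) - 1‖ ≤ (C * r) * r ^ K := fun K => by
    calc ‖z (K + 1 + 1) / z (K + 1) - 1‖ ≤ C * r ^ (K + 1) := hε (K + 1) (Nat.le_add_left 1 K)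
      _ = (C * r) * r ^ K := by rw [pow_succ]; ring
  obtain ⟨ℓ, hℓ0, hℓ, hq⟩ :=
    ratio_limit (z := fun K => z (K + 1)) (mul_nonneg hC hr0) hr0 hr1 hz' hε'
  refine ⟨ℓ, hℓ0, (Filter.tendsto_add_atTop_iff_nat 1).1 hℓ, fun K hK => ?_⟩
  obtain ⟨K, rfl⟩ := Nat.exists_eq_add_of_le' hK
  have hCr : C * r ≤ C := mul_le_of_le_one_right hC hr1.le
  calc ‖ℓ / z (K + 1) - 1‖ ≤ C * r * Real.exp (C * r / (1 - r)) / (1 - r) * r ^ K := hq K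
    _ ≤ C * r * Real.exp (C / (1 - r)) / (1 - r) * r ^ K := by gcongr
    _ = C * Real.exp (C / (1 - r)) / (1 - r) * r ^ (K + 1) := by rw [pow_succ]; ring

end Summit.CriticalPhenomena.CardyFormulaZ2.Theorems.MarkovBlockPresentation
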